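import Mathlib
import Summits.Ventures.PercRepro2.TB14Hall

/-!
# Row 2′TB (typed BHK 1.4 single-vertex): HALL ON THE JUNCTION CLASS ⟹ THE ROW (blind cell
PercRepro2, p5 g5, 2026-08-25; P5-RULES.md §6.4)

The region swap `ι₂ = swapRegion` of TB14Fold (complement every free edge touching the region of
`a₂`) is an involution that exchanges the two clusters of `a₂` and preserves admissibility, so for
a SOURCE `y` it produces a TARGET exactly when `b` stays joined to `a₁` (`isTgt_swapRegion_iff`),
and it matches these GOOD sources bijectively to the good targets (targets whose swap is a source).
The open content of the row is the JUNCTION class — the BAD sources (`b` lost under the swap)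
against the BAD targets (`badSrcSet` / `badTgtSet`).

* `tb14_of_hall_junction`: Hall's condition for ANY family of moves from the bad sources into the
  bad targets gives the row — the Hall injection on the bad sources and `ι₂` on the good sources
  together form an injection `Src → Tgt` (`TB14Hall.tb14_of_injOn`).
* `tb14_of_hall_junction_starFlip`: the same for a family of star flips.

Census (P5-RULES.md §6.4): the junction sub-problem satisfies Hall for the flips
«`o ∈ Z ⊆ (T ∪ T′) ∖ {a₂}`, `Z` connected» on every graph with `≤ 8` vertices and `≤ 10` edges.
Nothing here proves the row; standard axioms.
-/

namespace Summit.Ventures.PercRepro2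

namespace TB14Hall

open CovForm A3InactiveTyped TB14Fold TB14FlipFamily

section Swap

variable {V : Type} {E : Type} [DecidableEq E]
variable (ends : E → Sym2 V) (a₁ a₂ : V) (F : Finset E)

/-- `a₁ ~ a₂` in `ι₂ y` iff `a₁ ~ a₂` in the second copy of `y`. -/
lemma conn_swapRegion_roots_iff (y : Config E) :
    Conn ends (swapRegion ends F a₂ y) a₁ a₂ ↔ Conn ends (A3InactiveTyped.flipOn F y) a₁ a₂ := by
  constructor
  · intro h
    have h' : a₁ ∈ cluster ends (swapRegion ends F a₂ y) a₂ := conn_symm h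
    rw [cluster_swapRegion] at h'
    exact conn_symm h'
  · intro h
    have h' : a₁ ∈ cluster ends (A3InactiveTyped.flipOn F y) a₂ := conn_symm h
    rw [← cluster_swapRegion ends F a₂ y] at h'
    exact conn_symm h'

/-- `a₁ ~ a₂` in the second copy of `ι₂ y` iff `a₁ ~ a₂` in `y`. -/
lemma conn_flip_swapRegion_roots_iff (y : Config E) :
    Conn ends (A3InactiveTyped.flipOn F (swapRegion ends F a₂ y)) a₁ a₂ ↔ Conn ends y a₁ a₂ := by
  constructor
  · intro h
    have h' : a₁ ∈ cluster ends (A3InactiveTyped.flipOn F (swapRegion ends F a₂ y)) a₂ := conn_symm h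
    rw [cluster_flip_swapRegion] at h'
    exact conn_symm h'
  · intro h
    have h' : a₁ ∈ cluster ends y a₂ := conn_symm h
    rw [← cluster_flip_swapRegion ends F a₂ y] at h'
    exact conn_symm h'

/-- `v ∈ C(a₂)` in `ι₂ y` iff `v ∈ C(a₂)` in the second copy of `y`. -/
lemma conn_swapRegion_a2_iff (y : Config E) (v : V) :
    Conn ends (swapRegion ends F a₂ y) a₂ v ↔ Conn ends (A3InactiveTyped.flipOn F y) a₂ v := by
  constructor
  · intro h
    have h' : v ∈ cluster ends (swapRegion ends F a₂ y) a₂ := h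
    rw [cluster_swapRegion] at h'
    exact h'
  · intro h
    have h' : v ∈ cluster ends (A3InactiveTyped.flipOn F y) a₂ := h
    rw [← cluster_swapRegion ends F a₂ y] at h'
    exact h'

/-- `v ∈ C(a₂)` in the second copy of `ι₂ y` iff `v ∈ C(a₂)` in `y`. -/
lemma conn_flip_swapRegion_a2_iff (y : Config E) (v : V) :
    Conn ends (A3InactiveTyped.flipOn F (swapRegion ends F a₂ y)) a₂ v ↔ Conn ends y a₂ v := by
  constructor
  · intro h
    have h' : v ∈ cluster ends (A3InactiveTyped.flipOn F (swapRegion ends F a₂ y)) a₂ := h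
    rw [cluster_flip_swapRegion] at h'
    exact h'
  · intro h
    have h' : v ∈ cluster ends y a₂ := h
    rw [← cluster_flip_swapRegion ends F a₂ y] at h'
    exact h'

end Swap

section GoodBad

variable {V : Type} {E : Type} [DecidableEq E]
variable (ends : E → Sym2 V) (a₁ a₂ b o : V) (F : Finset E)

/-- **A source is GOOD exactly when `b` stays joined to `a₁` after the region swap**: for a source
`y`, `ι₂ y` is a target iff `Conn (ι₂ y) a₁ b`. -/
lemma isTgt_swapRegion_iff {y : Config E} (hs : IsSrc ends a₁ a₂ b o F y) :
    IsTgt ends a₁ a₂ b o F (swapRegion ends F a₂ y) ↔ Conn ends (swapRegion ends F a₂ y) a₁ b := by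
  constructor
  · intro ht; exact ht.hb
  · intro hb
    refine ⟨?_, ?_, hb, ?_, ?_⟩
    · exact fun h => hs.q₂ ((conn_swapRegion_roots_iff ends a₁ a₂ F y).1 h)
    · exact fun h => hs.q₁ ((conn_flip_swapRegion_roots_iff ends a₁ a₂ F y).1 h)
    · exact (conn_flip_swapRegion_a2_iff ends a₂ F y o).2 hs.ho
    · exact fun h => hs.ho' ((conn_swapRegion_a2_iff ends a₂ F y o).1 h)

/-- For a target `w`, `ι₂ w` is a source iff `Conn (ι₂ w) a₁ b`. -/
lemma isSrc_swapRegion_iff {w : Config E} (ht : IsTgt ends a₁ a₂ b o F w) :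
    IsSrc ends a₁ a₂ b o F (swapRegion ends F a₂ w) ↔ Conn ends (swapRegion ends F a₂ w) a₁ b := by
  constructor
  · intro hs; exact hs.hb
  · intro hb
    refine ⟨?_, ?_, hb, ?_, ?_⟩
    · exact fun h => ht.q₂ ((conn_swapRegion_roots_iff ends a₁ a₂ F w).1 h)
    · exact fun h => ht.q₁ ((conn_flip_swapRegion_roots_iff ends a₁ a₂ F w).1 h)
    · exact (conn_swapRegion_a2_iff ends a₂ F w o).2 ht.ho
    · exact fun h => ht.ho' ((conn_flip_swapRegion_a2_iff ends a₂ F w o).1 h)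

end GoodBad

section Junction

variable {V : Type} {E : Type} [Fintype E] [DecidableEq E]
variable {R : Type*} [Field R] [LinearOrder R] [IsStrictOrderedRing R]
variable (ends : E → Sym2 V) (a₁ a₂ b o : V) (F : Finset E) (z : Config E)

open Classical in
/-- The BAD sources at the profile: admissible sources whose region swap loses `b` (the junction
class of row 2′TB). -/
noncomputable def badSrcSet : Finset (Config E) :=
  (srcSet ends a₁ a₂ b o F z).filter fun y => ¬ Conn ends (swapRegion ends F a₂ y) a₁ b

open Classical in
/-- The BAD targets at the profile: admissible targets whose region swap is not a source. -/
noncomputable def badTgtSet : Finset (Config E) :=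
  (tgtSet ends a₁ a₂ b o F z).filter fun w => ¬ Conn ends (swapRegion ends F a₂ w) a₁ b

/-- **HALL ON THE JUNCTION CLASS ⟹ THE ROW**: if the bad sources have a family of moves into the
bad targets satisfying Hall's condition, then (TB14) holds at the profile — the Hall injection on
the bad sources together with the region swap on the good sources is an injection `Src → Tgt`. -/
theorem tb14_of_hall_junction (moves : Config E → Finset (Config E))
    (hmoves : ∀ y ∈ badSrcSet ends a₁ a₂ b o F z, moves y ⊆ badTgtSet ends a₁ a₂ b o F z)
    (hhall : ∀ S ⊆ badSrcSet ends a₁ a₂ b o F z, S.card ≤ (S.biUnion moves).card) :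
    pairCount F z (sameBO ends a₁ a₂ b o : Config E → Config E → R) ≤
      pairCount F z (crossBO ends a₁ a₂ b o) := by
  classical
  set Bad := badSrcSet ends a₁ a₂ b o F z with hBad
  -- Hall's theorem on the subtype of bad sources
  have hhall' : ∀ s : Finset {y // y ∈ Bad}, s.card ≤ (s.biUnion fun y => moves y.1).card := by
    intro s
    have hsub : s.image Subtype.val ⊆ Bad := by
      intro y hy
      obtain ⟨⟨y', hy'⟩, -, rfl⟩ := Finset.mem_image.1 hy
      exact hy'
    have := hhall _ hsub
    rwa [Finset.card_image_of_injective s Subtype.val_injective, Finset.image_biUnion] at this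
  obtain ⟨g, hginj, hgmem⟩ := (Finset.all_card_le_biUnion_card_iff_exists_injective
    (fun y : {y // y ∈ Bad} => moves y.1)).1 hhall'
  -- the combined map: the region swap on the good sources, `g` on the bad ones
  let f : Config E → Config E := fun y =>
    if Conn ends (swapRegion ends F a₂ y) a₁ b then swapRegion ends F a₂ y
    else if h : y ∈ Bad then g ⟨y, h⟩ else y
  have hgood : ∀ y, Conn ends (swapRegion ends F a₂ y) a₁ b → f y = swapRegion ends F a₂ y := by
    intro y hy; simp only [f, if_pos hy]
  have hbad : ∀ y (hy : y ∈ Bad), f y = g ⟨y, hy⟩ := by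
    intro y hy
    have hnot : ¬ Conn ends (swapRegion ends F a₂ y) a₁ b := (Finset.mem_filter.1 hy).2
    simp only [f, if_neg hnot, dif_pos hy]
  -- a bad source's image is a bad target
  have hgT : ∀ y (hy : y ∈ Bad), g ⟨y, hy⟩ ∈ badTgtSet ends a₁ a₂ b o F z :=
    fun y hy => hmoves y hy (hgmem ⟨y, hy⟩)
  refine tb14_of_injOn ends a₁ a₂ b o F z f ?_ ?_
  · -- sources go to targets
    intro y hy
    have hy' := Finset.mem_filter.1 hy
    by_cases hc : Conn ends (swapRegion ends F a₂ y) a₁ b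
    · rw [hgood y hc]
      exact Finset.mem_filter.2 ⟨Finset.mem_univ _, swapRegion_agree hy'.2.1,
        (isTgt_swapRegion_iff ends a₁ a₂ b o F hy'.2.2).2 hc⟩
    · have hyB : y ∈ Bad := Finset.mem_filter.2 ⟨hy, hc⟩
      rw [hbad y hyB]
      exact (Finset.mem_filter.1 (hgT y hyB)).1
  · -- injective on the sources
    intro y hy y' hy' hf
    rw [Finset.mem_coe] at hy hy'
    have hys := (Finset.mem_filter.1 hy).2.2
    have hys' := (Finset.mem_filter.1 hy').2.2
    by_cases hc : Conn ends (swapRegion ends F a₂ y) a₁ b <;>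
      by_cases hc' : Conn ends (swapRegion ends F a₂ y') a₁ b
    · -- both good: `ι₂` is an involution
      rw [hgood y hc, hgood y' hc'] at hf
      have := congrArg (swapRegion ends F a₂) hf
      rwa [swapRegion_swapRegion, swapRegion_swapRegion] at this
    · -- `y` good, `y'` bad: the image of `y'` is a bad target, the image of `y` is not
      have hyB' : y' ∈ Bad := Finset.mem_filter.2 ⟨hy', hc'⟩
      rw [hgood y hc, hbad y' hyB'] at hf
      have hbadT := (Finset.mem_filter.1 (hgT y' hyB')).2
      rw [← hf, swapRegion_swapRegion] at hbadT
      exact absurd hys.hb hbadT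
    · -- `y` bad, `y'` good: symmetric
      have hyB : y ∈ Bad := Finset.mem_filter.2 ⟨hy, hc⟩
      rw [hbad y hyB, hgood y' hc'] at hf
      have hbadT := (Finset.mem_filter.1 (hgT y hyB)).2
      rw [hf, swapRegion_swapRegion] at hbadT
      exact absurd hys'.hb hbadT
    · -- both bad: `g` is injective
      have hyB : y ∈ Bad := Finset.mem_filter.2 ⟨hy, hc⟩
      have hyB' : y' ∈ Bad := Finset.mem_filter.2 ⟨hy', hc'⟩
      rw [hbad y hyB, hbad y' hyB'] at hf
      exact congrArg Subtype.val (hginj hf)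

open Classical in
/-- **Hall on the junction class for a family of STAR FLIPS ⟹ the row**: `fam y` is any finite
family of vertex sets whose star flips of the bad source `y` are bad targets. -/
theorem tb14_of_hall_junction_starFlip (fam : Config E → Finset (Finset V))
    (hfam : ∀ y ∈ badSrcSet ends a₁ a₂ b o F z, ∀ Z ∈ fam y,
      starFlip ends Z y ∈ badTgtSet ends a₁ a₂ b o F z)
    (hhall : ∀ S ⊆ badSrcSet ends a₁ a₂ b o F z,
      S.card ≤ (S.biUnion fun y => (fam y).image fun Z => starFlip ends Z y).card) :
    pairCount F z (sameBO ends a₁ a₂ b o : Config E → Config E → R) ≤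
      pairCount F z (crossBO ends a₁ a₂ b o) := by
  refine tb14_of_hall_junction ends a₁ a₂ b o F z
    (fun y => (fam y).image fun Z => starFlip ends Z y) ?_ hhall
  intro y hy w hw
  obtain ⟨Z, hZ, rfl⟩ := Finset.mem_image.1 hw
  exact hfam y hy Z hZ

end Junction

end TB14Hall

end Summit.Ventures.PercRepro2
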